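import Summits.BirchSwinnertonDyer.BirchSwinnertonDyer.Theorems.SmallImageMuTransferMuTransferX9RelativeShapiro
import Literature.NumberTheory.EllipticCurves.IwasawaTwistModPkTower
import Summits.BirchSwinnertonDyer.BirchSwinnertonDyer.Theorems.OneSidedTwistSqueezeX9KatoDivisibilityX9StubReciprocityPkX9Transfer
import HarnessLib

set_option autoImplicit false

-- the summit and its single problem are both named `BirchSwinnertonDyer` (registry layout D-0017)
set_option linter.dupNamespace false

/-!
# Crux `KatoDivisibilityX9` (stmt-BirchSwinnertonDyer-20547), line `graded_euler_loss`, stub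
# `stub_reciprocityPkAX9` (hG34ᵍ), item (M1) of `hKolyRecPk`, file 2: the level-`p^k` Shapiro dictionary
# `conj_g ↔ (1+S)^{−κ̄_n(g)}` for `coresShapiroPk`, polynomials in `conj_g` on COCYCLES, and the relative inverse
# Shapiro map inside `N = Gal(K̄/K(μ_ℓ))`

Seat `bsd-line-k6-p4` (prover-bsd-line-k6-p4-g5-0, wave-2 stub worker B).  THEOREMS ONLY (no definition, no named
fact, no `sorry`); generic (`K` a field, `κ : ZpExtension K p`, `ρ` a discrete `Γ_K`-module with `p^k • M = 0`);
`--supports stmt-BirchSwinnertonDyer-20547 --as helper`.  Level-`p^k` twin of k6-ty's `IwasawaTwistModPShapiroConj`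
(`coresShapiro_conjMap`), koly's `…X9TameClass` §1 (`exists_cocycle_coresShapiro_aeval_conjMap`) and
`…X9RelativeShapiro` §2 (`cores_coresLe_cohomologyMap_unitCoeff`) for the LOSSY level-`p^k` inverse Shapiro map
`κ.coresShapiroPk ρ hM J n h : H¹(Γ_n, M) → H¹(K, 𝒯_J^{(k)})`, `J ≤ p^{n+1−k}` (tree `IwasawaTwistModPkTower`).
Since Theorems files carry no definitions, the equivariant operator `(1+S)^a` (more generally `F(S)`,
`F ∈ ℤ[X]`) on `𝒯_J^{(k)}` enters as ANY continuous intertwining map `fI` with the prescribed values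
(`exists_contIntertwiningMap_aeval_shiftEnd` supplies one).

* §1 `aeval_shiftEnd_twistModPk_apply` (polynomials in `S` are `Γ_K`-equivariant on `𝒯_J^{(k)}`),
  `exists_contIntertwiningMap_aeval_shiftEnd`.
* §2 `unipotentPow_twistModPk_unitCoeffPk` (`(1+S)^a (g·(m T⁰)) = (ρ(g)m) T⁰` for `a ≡ −κ̄_n(g) (mod p^n)`),
  **`coresShapiroPk_conjMap`** (`Sh (g·c) = H¹((1+S)^a)(Sh c)`), `coresShapiroPk_pow_conjMap`,
  **`exists_cocycle_coresShapiroPk_aeval_conjMap`** (`Sh (P(conj_g) c) = [ψ]`, `ψ(x) = P((1+S)^a)(φ(x))` for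
  `[φ] = Sh c`).
* §3 **`cores_coresLe_cohomologyMap_unitCoeffPk`**: `cor_N^{Γ_K} ∘ Sh_N = Sh ∘ cor_{N∩Γ_n}^{Γ_n}` for the relative
  map `Sh_N c := cor_{N∩Γ_n}^{N} (H¹(m ↦ m T⁰) c)`.

References: J.-P. Serre, *Galois Cohomology* (1997) I §2.2, §2.5 Prop. 10 and (b) [SerreGaloisCohomology1997];
J. Neukirch, A. Schmidt, K. Wingberg (2008) (1.6.4)–(1.6.5), Prop. 1.5.4 [NeukirchSchmidtWingberg2008];
L. Washington, GTM 83, §13.1–13.2 [Washington1997]; B. Mazur, K. Rubin, Mem. AMS 799 (2004) §5.3 [MazurRubin2004].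
-/

noncomputable section

open CategoryTheory Function Finset Polynomial
open scoped ContRepresentation
open Field
open Literature.NumberTheory.GaloisRepresentations
open Literature.NumberTheory.EllipticCurves
open Literature.NumberTheory.EllipticCurves.ZpExtension

universe u

namespace Summit.BirchSwinnertonDyer.BirchSwinnertonDyer.Theorems.OneSidedTwistSqueezeX9KatoDivisibilityX9KolyvaginReciprocityPkShapiro

variable {K : Type u} [Field K] {p : ℕ} [Fact p.Prime] (κ : ZpExtension K p)
variable {M : Type u} [AddCommGroup M] [TopologicalSpace M] [DiscreteTopology M] {k : ℕ}
variable (ρ : DiscreteGaloisModule K M) (hM : ∀ m : M, p ^ k • m = 0) (J : ℕ)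

/-! ## §1 Polynomials in the shift are equivariant on `𝒯_J^{(k)}` -/

/-- **`F(S)` commutes with the twisted action on `𝒯_J^{(k)}`** for every `F ∈ ℤ[X]` (`S` does:
`shiftEnd_twistModPk_apply`; the action is additive). [cite: Washington1997, §13.1–§13.2] -/
theorem aeval_shiftEnd_twistModPk_apply (F : ℤ[X]) (g : absoluteGaloisGroup K) (x : Fin J → M) :
    aeval (shiftEnd M J) F (κ.twistModPk ρ hM J g x) = κ.twistModPk ρ hM J g (aeval (shiftEnd M J) F x) := by
  induction F using Polynomial.induction_on' with
  | add F G hF hG => rw [map_add, LinearMap.add_apply, LinearMap.add_apply, hF, hG, map_add]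
  | monomial i b =>
    rw [aeval_monomial, Module.End.mul_apply, Module.End.mul_apply, algebraMap_int_eq, Int.coe_castRingHom,
      Module.End.intCast_apply, Module.End.intCast_apply, map_zsmul]
    congr 1
    induction i generalizing x with
    | zero => rw [pow_zero, Module.End.one_apply, Module.End.one_apply]
    | succ i ih => rw [pow_succ, Module.End.mul_apply, Module.End.mul_apply, κ.shiftEnd_twistModPk_apply, ih]

/-- **`F(S)` as a continuous intertwining endomorphism of `𝒯_J^{(k)}`** (existence; Theorems files carry no
definitions, so consumers quantify over such maps). [cite: SerreGaloisCohomology1997, I §2.2] -/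
theorem exists_contIntertwiningMap_aeval_shiftEnd (F : ℤ[X]) :
    ∃ fI : (κ.twistModPk ρ hM J).toContRepresentation →ⁱL (κ.twistModPk ρ hM J).toContRepresentation,
      ∀ x, fI x = aeval (shiftEnd M J) F x :=
  ⟨{ toContinuousLinearMap :=
        { toFun := aeval (shiftEnd M J) F
          map_add' := map_add _
          map_smul' := fun c x => by rw [map_zsmul, RingHom.id_apply]
          cont := continuous_of_discreteTopology }
     isIntertwining' := fun g => ContinuousLinearMap.ext fun x =>
       aeval_shiftEnd_twistModPk_apply κ ρ hM J F g x }, fun _ => rfl⟩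

/-- Hence an intertwining endomorphism of `𝒯_J^{(k)}` acting as `(1+S)^a` exists.
[cite: SerreGaloisCohomology1997, I §2.2] -/
theorem exists_contIntertwiningMap_unipotentPow (a : ℕ) :
    ∃ fI : (κ.twistModPk ρ hM J).toContRepresentation →ⁱL (κ.twistModPk ρ hM J).toContRepresentation,
      ∀ x, fI x = unipotentPow M J a x := by
  obtain ⟨fI, hfI⟩ := exists_contIntertwiningMap_aeval_shiftEnd κ ρ hM J ((X + 1 : ℤ[X]) ^ a)
  exact ⟨fI, fun x => by rw [hfI, Summit.BirchSwinnertonDyer.BirchSwinnertonDyer.Theorems.OneSidedTwistSqueezeX9KatoDivisibilityX9StubReciprocityPkX9Transfer.unipotentPow_eq_aeval]⟩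

/-- `H¹(fI)` on an explicit cocycle: `[φ] ↦ [fI ∘ φ]`. [cite: SerreGaloisCohomology1997, I §2.2] -/
theorem exists_cocycle_map_oneCocycleClass
    (fI : (κ.twistModPk ρ hM J).toContRepresentation →ⁱL (κ.twistModPk ρ hM J).toContRepresentation)
    (φ : contOneCocycles (κ.twistModPk ρ hM J).toTopRep) :
    ∃ ψ : contOneCocycles (κ.twistModPk ρ hM J).toTopRep, (∀ g, ψ.1 g = fI (φ.1 g)) ∧
      galoisCohomology.map fI 1 (oneCocycleClass _ φ) = oneCocycleClass _ ψ :=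
  ⟨contOneCocycles.pullback (ContinuousMonoidHom.id (absoluteGaloisGroup K))
    (X := (κ.twistModPk ρ hM J).toTopRep) (Y := (κ.twistModPk ρ hM J).toTopRep)
    (TopRep.ofHom ⟨fI.toContinuousLinearMap, fI.isIntertwining'⟩) φ, fun _ => rfl,
    galoisCohomology.map_oneCocycleClass_ofHom fI φ⟩

/-- Iterates: `(H¹(fI))^[i] [φ] = [ψ]` with `ψ(g) = fI^[i] (φ(g))`. [cite: SerreGaloisCohomology1997, I §2.2] -/
theorem exists_cocycle_map_iterate_oneCocycleClass
    (fI : (κ.twistModPk ρ hM J).toContRepresentation →ⁱL (κ.twistModPk ρ hM J).toContRepresentation) (i : ℕ)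
    (φ : contOneCocycles (κ.twistModPk ρ hM J).toTopRep) :
    ∃ ψ : contOneCocycles (κ.twistModPk ρ hM J).toTopRep, (∀ g, ψ.1 g = (fun x => fI x)^[i] (φ.1 g)) ∧
      (galoisCohomology.map fI 1)^[i] (oneCocycleClass _ φ) = oneCocycleClass _ ψ := by
  induction i with
  | zero => exact ⟨φ, fun g => rfl, rfl⟩
  | succ i ih =>
    obtain ⟨ψ, hψ, hmap⟩ := ih
    obtain ⟨ψ', hψ', hmap'⟩ := exists_cocycle_map_oneCocycleClass κ ρ hM J fI ψ
    refine ⟨ψ', fun g => ?_, ?_⟩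
    · rw [hψ', hψ, Function.iterate_succ_apply']
    · rw [Function.iterate_succ_apply', hmap, hmap']

/-! ## §2 `conj_g ↔ (1+S)^{−κ̄_n(g)}` under `coresShapiroPk` -/

section ConjDictionary

variable (n : ℕ)

/-- **`(1+S)^a (g · (m·T⁰)) = (ρ(g) m)·T⁰` in `𝒯_J^{(k)}` when `a ≡ −κ̄_n(g) (mod p^n)` and `J ≤ p^{n+1−k}`**:
`g` acts on `m·T⁰` by `(1+S)^{κ(g) mod p^n}` after `ρ(g)` (`twistModPk_apply_of_level`), and `(1+S)^{p^n} = 1`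
on `𝒯_J^{(k)}` (`unipotentPow_eq_one_of_dvd_of_pow_smul`). [cite: Washington1997, §13.1–§13.2] -/
theorem unipotentPow_twistModPk_unitCoeffPk (h : J ≤ p ^ (n + 1 - k)) (g : absoluteGaloisGroup K) {a : ℕ}
    (ha : (a : ZMod (p ^ n)) = -κ.layerIndex n g) (m : M) :
    unipotentPow M J a (κ.twistModPk ρ hM J g (unitCoeffPk J m)) = unitCoeffPk J (ρ g m) := by
  rw [κ.twistModPk_apply_of_level ρ hM J h, ← Module.End.mul_apply, ← unipotentPow_add,
    map_unitCoeffPk_apply J (ρ g) m]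
  have hdvd : p ^ n ∣ a + κ.twistExponent n g := by
    rw [← ZMod.natCast_eq_zero_iff, Nat.cast_add, ha, κ.natCast_twistExponent n n le_rfl,
      neg_add_cancel]
  rw [unipotentPow_eq_one_of_dvd_of_pow_smul hM h hdvd, Module.End.one_apply]

variable [Fintype (absoluteGaloisGroup K ⧸ κ.layerSubgroup n)]

/-- **The dictionary `γ ↔ (1+S)^{−κ̄(γ)}` on `H¹` at level `p^k`.**  For `g ∈ Γ_K`, `c ∈ H¹(Γ_n, M)`, `a : ℕ` with
`a ≡ −κ̄_n(g) (mod p^n)`, `J ≤ p^{n+1−k}` and any intertwining `fI` acting as `(1+S)^a`: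
`coresShapiroPk (g · c) = H¹(fI) (coresShapiroPk c)` in `H¹(K, 𝒯_J^{(k)})` — on cocycles
`(g·φ)·T⁰ = (1+S)^a·(g·(φ·T⁰))`; `cor` commutes with the equivariant `fI` (`cohomologyMap_cores`) and
`cor (g · y) = cor y` (`cores_conjMap`). [cite: SerreGaloisCohomology1997, I §2.5 (b) and Exercise 1]
[cite: NeukirchSchmidtWingberg2008, Prop. 1.5.4] -/
theorem coresShapiroPk_conjMap (h : J ≤ p ^ (n + 1 - k)) (g : absoluteGaloisGroup K) {a : ℕ}
    (ha : (a : ZMod (p ^ n)) = -κ.layerIndex n g)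
    (fI : (κ.twistModPk ρ hM J).toContRepresentation →ⁱL (κ.twistModPk ρ hM J).toContRepresentation)
    (hfI : ∀ x, fI x = unipotentPow M J a x)
    (c : continuousCohomology 1 (subgroupRep ρ.toTopRep (κ.layerSubgroup n))) :
    κ.coresShapiroPk ρ hM J n h (conjMap ρ.toTopRep (κ.layerSubgroup n) g 1 c) =
      galoisCohomology.map fI 1 (κ.coresShapiroPk ρ hM J n h c) := by
  classical
  obtain ⟨φ, rfl⟩ := oneCocycleClass_surjective _ c
  -- the `Γ_K`-equivariant coefficient map `(1+S)^a` as a morphism of `TopRep`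
  set F : (κ.twistModPk ρ hM J).toTopRep ⟶ (κ.twistModPk ρ hM J).toTopRep :=
    TopRep.ofHom ⟨fI.toContinuousLinearMap, fI.isIntertwining'⟩ with hF
  -- cocycle identity: `(g·φ)·T⁰ = (1+S)^a · (g · (φ·T⁰))`
  have hcocycle :
      contOneCocycles.pullback (ContinuousMonoidHom.id _) (resIdHom (κ.unitCoeffPkHom ρ hM J n h))
          (contOneCocycles.pullback (subgroupConj (κ.layerSubgroup n) g)
            (conjRepHom ρ.toTopRep (κ.layerSubgroup n) g) φ) =
        contOneCocycles.pullback (ContinuousMonoidHom.id _)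
          (resIdHom (subgroupRepHom F (κ.layerSubgroup n)))
          (contOneCocycles.pullback (subgroupConj (κ.layerSubgroup n) g)
            (conjRepHom (κ.twistModPk ρ hM J).toTopRep (κ.layerSubgroup n) g)
            (contOneCocycles.pullback (ContinuousMonoidHom.id _)
              (resIdHom (κ.unitCoeffPkHom ρ hM J n h)) φ)) := by
    refine Subtype.ext (ContinuousMap.ext fun u ↦ ?_)
    rw [pullback_id_resIdHom_apply, conj_pullback_apply, pullback_id_resIdHom_apply,
      conj_pullback_apply, pullback_id_resIdHom_apply, unitCoeffPkHom_hom_apply, unitCoeffPkHom_hom_apply,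
      subgroupRepHom_hom_apply, ContinuousRep.toTopRep_ρ_apply, ContinuousRep.toTopRep_ρ_apply]
    change _ = fI _
    rw [hfI]
    exact (unipotentPow_twistModPk_unitCoeffPk κ ρ hM J n h g ha _).symm
  -- assemble
  rw [conjMap_oneCocycleClass, coresShapiroPk_apply, coresShapiroPk_apply,
    galoisCohomology.map_eq_cohomologyMap_apply]
  change cores _ _ _ (cohomologyMap (κ.unitCoeffPkHom ρ hM J n h) 1 (oneCocycleClass _ _)) =
    cohomologyMap F 1 (cores _ _ _ (cohomologyMap (κ.unitCoeffPkHom ρ hM J n h) 1 (oneCocycleClass _ φ)))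
  conv_lhs => rw [cohomologyMap_oneCocycleClass, hcocycle, ← cohomologyMap_oneCocycleClass,
    ← conjMap_oneCocycleClass, ← cohomologyMap_oneCocycleClass]
  rw [← cohomologyMap_cores, cores_conjMap]

/-- `Sh((g·)^i c) = H¹(fI)^[i] (Sh c)` (the dictionary iterated). [cite: SerreGaloisCohomology1997, I §2.5 (b)] -/
theorem coresShapiroPk_pow_conjMap (h : J ≤ p ^ (n + 1 - k)) (g : absoluteGaloisGroup K) {a : ℕ}
    (ha : (a : ZMod (p ^ n)) = -κ.layerIndex n g)
    (fI : (κ.twistModPk ρ hM J).toContRepresentation →ⁱL (κ.twistModPk ρ hM J).toContRepresentation)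
    (hfI : ∀ x, fI x = unipotentPow M J a x)
    (c : continuousCohomology 1 (subgroupRep ρ.toTopRep (κ.layerSubgroup n))) (i : ℕ) :
    κ.coresShapiroPk ρ hM J n h (((conjMap ρ.toTopRep (κ.layerSubgroup n) g 1).hom.toLinearMap ^ i) c) =
      (galoisCohomology.map fI 1)^[i] (κ.coresShapiroPk ρ hM J n h c) := by
  induction i with
  | zero => rw [pow_zero, Module.End.one_apply, Function.iterate_zero_apply]
  | succ i ih =>
    rw [pow_succ', Module.End.mul_apply, Function.iterate_succ_apply', ← ih]
    exact coresShapiroPk_conjMap κ ρ hM J n h g ha fI hfI _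

/-- **`Sh (P(conj_g) c) = [ψ]` with `ψ(x) = P((1+S)^a)(φ(x))`** for `[φ] = Sh c`, `P ∈ ℤ[X]`, `a ≡ −κ̄_n(g) (mod p^n)`,
`J ≤ p^{n+1−k}`: the polynomial calculus of `H¹`-operators carried out on COCYCLES, so that only values in the
module `𝒯_J^{(k)}` are compared (level-`p^k` twin of koly's `exists_cocycle_coresShapiro_aeval_conjMap`).
[cite: SerreGaloisCohomology1997, I §2.2 and §2.5 (b)] -/
theorem exists_cocycle_coresShapiroPk_aeval_conjMap (h : J ≤ p ^ (n + 1 - k)) (g : absoluteGaloisGroup K)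
    {a : ℕ} (ha : (a : ZMod (p ^ n)) = -κ.layerIndex n g) (P : ℤ[X])
    (c : continuousCohomology 1 (subgroupRep ρ.toTopRep (κ.layerSubgroup n)))
    (φ : contOneCocycles (κ.twistModPk ρ hM J).toTopRep)
    (hφ : oneCocycleClass _ φ = κ.coresShapiroPk ρ hM J n h c) :
    ∃ ψ : contOneCocycles (κ.twistModPk ρ hM J).toTopRep,
      (∀ x, ψ.1 x = aeval (unipotentPow M J a) P (φ.1 x)) ∧
      κ.coresShapiroPk ρ hM J n h
          (aeval (conjMap ρ.toTopRep (κ.layerSubgroup n) g 1).hom.toLinearMap P c) =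
        oneCocycleClass _ ψ := by
  obtain ⟨fI, hfI⟩ := exists_contIntertwiningMap_unipotentPow κ ρ hM J a
  induction P using Polynomial.induction_on' with
  | add P Q hP hQ =>
    obtain ⟨ψ₁, hψ₁, h₁⟩ := hP
    obtain ⟨ψ₂, hψ₂, h₂⟩ := hQ
    refine ⟨ψ₁ + ψ₂, fun x ↦ ?_, ?_⟩
    · rw [Submodule.coe_add, ContinuousMap.add_apply, hψ₁, hψ₂, aeval_add, LinearMap.add_apply]
    · rw [aeval_add, LinearMap.add_apply, map_add, h₁, h₂, oneCocycleClass_add]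
      rfl
  | monomial i b =>
    have hiter : ∀ (j : ℕ) (y : Fin J → M), (fun x => fI x)^[j] y = (unipotentPow M J a ^ j) y := by
      intro j
      induction j with
      | zero => intro y; rfl
      | succ j ih => intro y; rw [Function.iterate_succ_apply', ih, hfI, pow_succ', Module.End.mul_apply]
    obtain ⟨ψ, hψ, hmap⟩ := exists_cocycle_map_iterate_oneCocycleClass κ ρ hM J fI i φ
    refine ⟨b • ψ, fun x ↦ ?_, ?_⟩
    · rw [Submodule.coe_smul, ContinuousMap.coe_smul, Pi.smul_apply, hψ, hiter, aeval_monomial,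
        Module.End.mul_apply, algebraMap_int_eq, Int.coe_castRingHom, Module.End.intCast_apply]
    · rw [aeval_monomial, Module.End.mul_apply, algebraMap_int_eq, Int.coe_castRingHom,
        Module.End.intCast_apply, map_zsmul, coresShapiroPk_pow_conjMap κ ρ hM J n h g ha fI hfI c i, ← hφ,
        hmap, ← oneCocycleClassₗ_apply, ← oneCocycleClassₗ_apply, map_zsmul]
      rfl

end ConjDictionary

/-! ## §3 The relative inverse Shapiro map inside `N` and its compatibility with `cor_N^{Γ_K}` -/

section RelativeShapiro

variable (n : ℕ) (N : Subgroup (absoluteGaloisGroup K))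

/-- **`cor_N^{Γ_K} ∘ Sh_N = Sh ∘ cor_{N ∩ Γ_n}^{Γ_n}` at level `p^k`.**  For the relative map
`Sh_N c := cor_{N ⊓ Γ_n}^{N} (H¹(unitCoeffPk) c)` (`c ∈ H¹(N ∩ Γ_n, M)`, values in `H¹(N, 𝒯_J^{(k)})`,
`J ≤ p^{n+1−k}`) one has `cor_N^{Γ_K} (Sh_N c) = coresShapiroPk n J (cor_{N ⊓ Γ_n}^{Γ_n} c)`: both sides equal
`cor_{N ⊓ Γ_n}^{Γ_K} (H¹(m ↦ m T⁰) c)` (transitivity of the transfer, naturality of `cor` in the coefficients).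
[cite: SerreGaloisCohomology1997, I §2.5 Prop. 10 and (b)] [cite: NeukirchSchmidtWingberg2008, (1.6.4)–(1.6.5) and Prop. 1.5.3] -/
theorem cores_coresLe_cohomologyMap_unitCoeffPk (h : J ≤ p ^ (n + 1 - k))
    (hN : IsOpen (N : Set (absoluteGaloisGroup K)))
    (hNn : IsOpen ((N ⊓ κ.layerSubgroup n : Subgroup (absoluteGaloisGroup K)) :
      Set (absoluteGaloisGroup K)))
    [Fintype (absoluteGaloisGroup K ⧸ N)] [Fintype (absoluteGaloisGroup K ⧸ κ.layerSubgroup n)]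
    [Fintype (absoluteGaloisGroup K ⧸ (N ⊓ κ.layerSubgroup n))]
    [Fintype (N ⧸ (N ⊓ κ.layerSubgroup n).subgroupOf N)]
    [Fintype (κ.layerSubgroup n ⧸ (N ⊓ κ.layerSubgroup n).subgroupOf (κ.layerSubgroup n))]
    (c : continuousCohomology 1 (subgroupRep ρ.toTopRep (N ⊓ κ.layerSubgroup n))) :
    cores (κ.twistModPk ρ hM J).toTopRep N hN
        (coresLe (κ.twistModPk ρ hM J).toTopRep
          (inf_le_left : N ⊓ κ.layerSubgroup n ≤ N) hNn
          (cohomologyMap (restrictHomOfLe (inf_le_right : N ⊓ κ.layerSubgroup n ≤ κ.layerSubgroup n)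
            (κ.unitCoeffPkHom ρ hM J n h)) 1 c)) =
      κ.coresShapiroPk ρ hM J n h
        (coresLe ρ.toTopRep (inf_le_right : N ⊓ κ.layerSubgroup n ≤ κ.layerSubgroup n) hNn c) := by
  rw [cores_coresLe_eq_cores, coresShapiroPk_apply, cohomologyMap_coresLe, cores_coresLe_eq_cores]

end RelativeShapiro

end Summit.BirchSwinnertonDyer.BirchSwinnertonDyer.Theorems.OneSidedTwistSqueezeX9KatoDivisibilityX9KolyvaginReciprocityPkShapiro

end
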